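import Summits.ResolutionOfSingularities.ResolutionOfSingularities.Theorems.EquisingularLiftEquisingularLiftNatEquinodalLift
import Mathlib.Tactic.FieldSimp
import Mathlib.Tactic.LinearCombination
import HarnessLib

/-!
# [OURS · L1 W4.5(b) · EL♮(3) · nose residue, door ν4, row (D6-3b)] (CERT-EQ) FOR THE CHEBYSHEV SPECIMEN S_ν(6;10)^{Ch} BY LAGRANGE SEPARATORS

Cell `res-hironaka`, rung L, slot W4.5(b); crux CHILD EL♮(3) = stmt-ResolutionOfSingularities-20148.  WIDTH seat res-L1-w45b-nose-w1 g3, desk R56 row (D6-3b)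
(re-dealt from res-L1-w45b-nose-w4's (D6-3)).  OURS; NOT a statement of any manuscript; nothing of [Hironaka2017]; AI kernel work, weaker than expert review;
EL♮(3) NOT proved; resolution in positive characteristic NOT proved (dim 3 = Cossart–Piltant 2008/2009).  `--supports stmt-ResolutionOfSingularities-20148 --as helper`.

WHAT.  The nose of the named customer S_ν(6;10)^{Ch} is the Chebyshev sextic `T₆(x) = T₅(y)` in `Π = {w = 0}`; its ten nodes are `(cos(jπ/6), cos(iπ/5))`,
`j ∈ 1..5`, `i ∈ 1..4`, `i ≡ j (mod 2)` (NU4-SIZING §M M.5 / §C C2).  In the SCALED chart `(4x : 4y : 1)` (the customer's free choice of hyperplane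
coordinates `B = diag(1, 1, 4)` in `EqCertAt₀`; fraction-free) they are the `3 × 2` grid `{2√3, 0, −2√3} × {1 + √5, 1 − √5}` (where `T₆ = T₅ = −1`) and the
`2 × 2` grid `{2, −2} × {√5 − 1, −1 − √5}` (where `T₆ = T₅ = +1`): `chebNodes s3 s5 : Fin 10 → Fin 3 → k` for square roots `s3² = 3`, `s5² = 5` in `k`.
**`certEq_chebyshev_surjective`**: for `char k ∉ {2, 3, 5}` (hypotheses `(2:k) ≠ 0`, `(3:k) ≠ 0`, `(5:k) ≠ 0`) evaluation at the ten nodes is SURJECTIVE from the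
degree-`6` ternary forms onto `k¹⁰` — the (CERT-EQ) conjunct of `EqCertAt₀` / the `hcert` input of `Equinodal.exists_equinodal_lift` (✓ p670351) — and
**`eqCertDet_chebyshev`**: hence ten degree-`6` monomials with invertible evaluation matrix exist (`Equinodal.exists_pivots_of_surjective`), the `EqCertDet`
shape.  PROOF WITHOUT A 10 × 10 DETERMINANT: LAGRANGE SEPARATORS `chebSep` — for each node a product of six linear forms (`x − a z`, `y − b z`, `x`, `z`) vanishing
at the nine other nodes (the factor `(x − 2z)(x + 2z)` kills the `2 × 2` grid, `x(x − 2√3 z)(x + 2√3 z)` kills the `3 × 2` grid, the remaining factors are the grid's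
own Lagrange factors) and non-zero at its node (a product of the atoms `2, s3, s5, s3 ± 1`, non-zero exactly when `char k ∉ {2, 3}` — `5 ≠ 0` keeps `s5 ≠ 0`);
`Equinodal.surjective_eval_of_separators` (generic).  Independent cross-check of the same fact: res-L1-w45b-nose-w4's integer certificate `U·M = 1024·1`
(✓ p668565 `SNuSixTen.certEq_chebyshev_leftInverse`, normal-form coordinates).  NOT here: that these ARE the nodes of `g₆^{Ch}` (the marked-point identities of
`EqCertAt₀`, `ring` identities modulo `s3² = 3`, `s5² = 5`), the cover clause, squarefreeness, (G1)/(G2)/(G4) for `B♮₁₀` — the rest of the customer sentence.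
-/

set_option linter.dupNamespace false

noncomputable section

open MvPolynomial

namespace Summit.ResolutionOfSingularities.ResolutionOfSingularities.Cruxes.EquisingularLiftNat.Sections.Equinodal

/-- **Separators ⇒ (CERT-EQ).** If every marked vector `v i` has a degree-`e` form vanishing at all the other marked vectors and not at `v i`, evaluation is
surjective from the degree-`e` forms onto `k^δ` (take `Σᵢ (wᵢ / hᵢ(vᵢ)) • hᵢ`). [folklore linear algebra] -/
theorem surjective_eval_of_separators {k : Type*} [Field k] {σ : Type*} {e δ : ℕ} (v : Fin δ → σ → k)
    (h : Fin δ → MvPolynomial σ k) (hh : ∀ i, (h i).IsHomogeneous e)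
    (hzero : ∀ i j, j ≠ i → eval (v j) (h i) = 0) (hne : ∀ i, eval (v i) (h i) ≠ 0) :
    Function.Surjective (fun p : homogeneousSubmodule σ k e => fun i => eval (v i) (p : MvPolynomial σ k)) := by
  classical
  intro w
  refine ⟨⟨∑ i, (w i / eval (v i) (h i)) • h i, ?_⟩, ?_⟩
  · exact Submodule.sum_mem _ fun i _ => Submodule.smul_mem _ _ (hh i)
  · funext j
    simp only [map_sum, smul_eval]
    rw [Finset.sum_eq_single j]
    · field_simp [hne j]
    · intro i _ hij
      rw [hzero i j (Ne.symm hij), mul_zero]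
    · intro hj; exact absurd (Finset.mem_univ j) hj

end Summit.ResolutionOfSingularities.ResolutionOfSingularities.Cruxes.EquisingularLiftNat.Sections.Equinodal

namespace Summit.ResolutionOfSingularities.ResolutionOfSingularities.Cruxes.EquisingularLiftNat.Sections.SNuSixTen

open Summit.ResolutionOfSingularities.ResolutionOfSingularities.Cruxes.EquisingularLiftNat.Sections.Equinodal

variable {k : Type} [Field k]

/-- The ten nodes of the Chebyshev sextic `T₆(x) = T₅(y)` in the SCALED chart `(4x : 4y : 1)`, given square roots `s3` of `3` and `s5` of `5`
(see the module docstring). [OURS · specimen datum] -/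
def chebNodes (s3 s5 : k) : Fin 10 → Fin 3 → k :=
  ![![2 * s3, s5 + 1, 1],
    ![2 * s3, -s5 + 1, 1],
    ![0, s5 + 1, 1],
    ![0, -s5 + 1, 1],
    ![-2 * s3, s5 + 1, 1],
    ![-2 * s3, -s5 + 1, 1],
    ![2, s5 - 1, 1],
    ![2, -s5 - 1, 1],
    ![-2, s5 - 1, 1],
    ![-2, -s5 - 1, 1]]

/-- Lagrange SEPARATORS for the ten nodes: products of six linear forms, hence ternary forms of degree `6`; the `i`-th vanishes at every node but the `i`-th.
[OURS · specimen datum] -/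
def chebSep (s3 s5 : k) : Fin 10 → MvPolynomial (Fin 3) k :=
  ![(X 0 - C (2) * X 2) * (X 0 - C (-2) * X 2) * (X 0 - C (0) * X 2) * (X 0 - C (-2 * s3) * X 2) * (X 1 - C (-s5 + 1) * X 2) * X 2,
    (X 0 - C (2) * X 2) * (X 0 - C (-2) * X 2) * (X 0 - C (0) * X 2) * (X 0 - C (-2 * s3) * X 2) * (X 1 - C (s5 + 1) * X 2) * X 2,
    (X 0 - C (2) * X 2) * (X 0 - C (-2) * X 2) * (X 0 - C (-2 * s3) * X 2) * (X 0 - C (2 * s3) * X 2) * (X 1 - C (-s5 + 1) * X 2) * X 2,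
    (X 0 - C (2) * X 2) * (X 0 - C (-2) * X 2) * (X 0 - C (-2 * s3) * X 2) * (X 0 - C (2 * s3) * X 2) * (X 1 - C (s5 + 1) * X 2) * X 2,
    (X 0 - C (2) * X 2) * (X 0 - C (-2) * X 2) * (X 0 - C (2 * s3) * X 2) * (X 0 - C (0) * X 2) * (X 1 - C (-s5 + 1) * X 2) * X 2,
    (X 0 - C (2) * X 2) * (X 0 - C (-2) * X 2) * (X 0 - C (2 * s3) * X 2) * (X 0 - C (0) * X 2) * (X 1 - C (s5 + 1) * X 2) * X 2,
    X 0 * (X 0 - C (2 * s3) * X 2) * (X 0 - C (-2 * s3) * X 2) * (X 0 - C (-2) * X 2) * (X 1 - C (-s5 - 1) * X 2) * X 2,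
    X 0 * (X 0 - C (2 * s3) * X 2) * (X 0 - C (-2 * s3) * X 2) * (X 0 - C (-2) * X 2) * (X 1 - C (s5 - 1) * X 2) * X 2,
    X 0 * (X 0 - C (2 * s3) * X 2) * (X 0 - C (-2 * s3) * X 2) * (X 0 - C (2) * X 2) * (X 1 - C (-s5 - 1) * X 2) * X 2,
    X 0 * (X 0 - C (2 * s3) * X 2) * (X 0 - C (-2 * s3) * X 2) * (X 0 - C (2) * X 2) * (X 1 - C (s5 - 1) * X 2) * X 2]

/-- a linear form `X i − a · X 2` is homogeneous of degree `1`. -/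
theorem isHomogeneous_X_sub_C_mul_X (i : Fin 3) (a : k) : (X i - C a * X 2 : MvPolynomial (Fin 3) k).IsHomogeneous 1 :=
  (isHomogeneous_X k i).sub ((isHomogeneous_X k 2).C_mul a)

/-- every separator is a form of degree `6` (six linear factors). -/
theorem isHomogeneous_chebSep (s3 s5 : k) (i : Fin 10) : (chebSep s3 s5 i).IsHomogeneous 6 := by
  have h6 : ∀ p₁ p₂ p₃ p₄ p₅ p₆ : MvPolynomial (Fin 3) k, p₁.IsHomogeneous 1 → p₂.IsHomogeneous 1 → p₃.IsHomogeneous 1 →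
      p₄.IsHomogeneous 1 → p₅.IsHomogeneous 1 → p₆.IsHomogeneous 1 → (p₁ * p₂ * p₃ * p₄ * p₅ * p₆).IsHomogeneous 6 :=
    fun p₁ p₂ p₃ p₄ p₅ p₆ h₁ h₂ h₃ h₄ h₅ h₆ => ((((h₁.mul h₂).mul h₃).mul h₄).mul h₅).mul h₆
  fin_cases i <;>
    exact h6 _ _ _ _ _ _ (by first | exact isHomogeneous_X_sub_C_mul_X _ _ | exact isHomogeneous_X k _)
      (isHomogeneous_X_sub_C_mul_X _ _) (isHomogeneous_X_sub_C_mul_X _ _) (isHomogeneous_X_sub_C_mul_X _ _)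
      (isHomogeneous_X_sub_C_mul_X _ _) (isHomogeneous_X k 2)

/-- the `0`-th separator at the `0`-th node (a product of non-zero atoms). -/
theorem eval_chebSep_self_0 (s3 s5 : k) :
    eval (chebNodes s3 s5 0) (chebSep s3 s5 0) = (2 : k) ^ 6 * (s3 - 1) * (s3 + 1) * s3 ^ 2 * s5 := by
  simp [chebNodes, chebSep]
  ring

/-- the `0`-th separator vanishes at every other node. -/
theorem eval_chebSep_other_0 (s3 s5 : k) :
    ∀ j : Fin 10, j ≠ 0 → eval (chebNodes s3 s5 j) (chebSep s3 s5 0) = 0 := by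
  intro j hij
  fin_cases j <;> first | exact absurd rfl hij | (simp [chebNodes, chebSep]; try ring)

/-- the `1`-th separator at the `1`-th node (a product of non-zero atoms). -/
theorem eval_chebSep_self_1 (s3 s5 : k) :
    eval (chebNodes s3 s5 1) (chebSep s3 s5 1) = -((2 : k) ^ 6 * (s3 - 1) * (s3 + 1) * s3 ^ 2 * s5) := by
  simp [chebNodes, chebSep]
  ring

/-- the `1`-th separator vanishes at every other node. -/
theorem eval_chebSep_other_1 (s3 s5 : k) :
    ∀ j : Fin 10, j ≠ 1 → eval (chebNodes s3 s5 j) (chebSep s3 s5 1) = 0 := by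
  intro j hij
  fin_cases j <;> first | exact absurd rfl hij | (simp [chebNodes, chebSep]; try ring)

/-- the `2`-th separator at the `2`-th node (a product of non-zero atoms). -/
theorem eval_chebSep_self_2 (s3 s5 : k) :
    eval (chebNodes s3 s5 2) (chebSep s3 s5 2) = (2 : k) ^ 5 * s3 ^ 2 * s5 := by
  simp [chebNodes, chebSep]
  ring

/-- the `2`-th separator vanishes at every other node. -/
theorem eval_chebSep_other_2 (s3 s5 : k) :
    ∀ j : Fin 10, j ≠ 2 → eval (chebNodes s3 s5 j) (chebSep s3 s5 2) = 0 := by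
  intro j hij
  fin_cases j <;> first | exact absurd rfl hij | (simp [chebNodes, chebSep]; try ring)

/-- the `3`-th separator at the `3`-th node (a product of non-zero atoms). -/
theorem eval_chebSep_self_3 (s3 s5 : k) :
    eval (chebNodes s3 s5 3) (chebSep s3 s5 3) = -((2 : k) ^ 5 * s3 ^ 2 * s5) := by
  simp [chebNodes, chebSep]
  ring

/-- the `3`-th separator vanishes at every other node. -/
theorem eval_chebSep_other_3 (s3 s5 : k) :
    ∀ j : Fin 10, j ≠ 3 → eval (chebNodes s3 s5 j) (chebSep s3 s5 3) = 0 := by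
  intro j hij
  fin_cases j <;> first | exact absurd rfl hij | (simp [chebNodes, chebSep]; try ring)

/-- the `4`-th separator at the `4`-th node (a product of non-zero atoms). -/
theorem eval_chebSep_self_4 (s3 s5 : k) :
    eval (chebNodes s3 s5 4) (chebSep s3 s5 4) = (2 : k) ^ 6 * (s3 + 1) * (s3 - 1) * s3 ^ 2 * s5 := by
  simp [chebNodes, chebSep]
  ring

/-- the `4`-th separator vanishes at every other node. -/
theorem eval_chebSep_other_4 (s3 s5 : k) :
    ∀ j : Fin 10, j ≠ 4 → eval (chebNodes s3 s5 j) (chebSep s3 s5 4) = 0 := by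
  intro j hij
  fin_cases j <;> first | exact absurd rfl hij | (simp [chebNodes, chebSep]; try ring)

/-- the `5`-th separator at the `5`-th node (a product of non-zero atoms). -/
theorem eval_chebSep_self_5 (s3 s5 : k) :
    eval (chebNodes s3 s5 5) (chebSep s3 s5 5) = -((2 : k) ^ 6 * (s3 + 1) * (s3 - 1) * s3 ^ 2 * s5) := by
  simp [chebNodes, chebSep]
  ring

/-- the `5`-th separator vanishes at every other node. -/
theorem eval_chebSep_other_5 (s3 s5 : k) :
    ∀ j : Fin 10, j ≠ 5 → eval (chebNodes s3 s5 j) (chebSep s3 s5 5) = 0 := by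
  intro j hij
  fin_cases j <;> first | exact absurd rfl hij | (simp [chebNodes, chebSep]; try ring)

/-- the `6`-th separator at the `6`-th node (a product of non-zero atoms). -/
theorem eval_chebSep_self_6 (s3 s5 : k) :
    eval (chebNodes s3 s5 6) (chebSep s3 s5 6) = -((2 : k) ^ 6 * (s3 - 1) * (s3 + 1) * s5) := by
  simp [chebNodes, chebSep]
  ring

/-- the `6`-th separator vanishes at every other node. -/
theorem eval_chebSep_other_6 (s3 s5 : k) :
    ∀ j : Fin 10, j ≠ 6 → eval (chebNodes s3 s5 j) (chebSep s3 s5 6) = 0 := by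
  intro j hij
  fin_cases j <;> first | exact absurd rfl hij | (simp [chebNodes, chebSep]; try ring)

/-- the `7`-th separator at the `7`-th node (a product of non-zero atoms). -/
theorem eval_chebSep_self_7 (s3 s5 : k) :
    eval (chebNodes s3 s5 7) (chebSep s3 s5 7) = (2 : k) ^ 6 * (s3 - 1) * (s3 + 1) * s5 := by
  simp [chebNodes, chebSep]
  ring

/-- the `7`-th separator vanishes at every other node. -/
theorem eval_chebSep_other_7 (s3 s5 : k) :
    ∀ j : Fin 10, j ≠ 7 → eval (chebNodes s3 s5 j) (chebSep s3 s5 7) = 0 := by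
  intro j hij
  fin_cases j <;> first | exact absurd rfl hij | (simp [chebNodes, chebSep]; try ring)

/-- the `8`-th separator at the `8`-th node (a product of non-zero atoms). -/
theorem eval_chebSep_self_8 (s3 s5 : k) :
    eval (chebNodes s3 s5 8) (chebSep s3 s5 8) = -((2 : k) ^ 6 * (s3 + 1) * (s3 - 1) * s5) := by
  simp [chebNodes, chebSep]
  ring

/-- the `8`-th separator vanishes at every other node. -/
theorem eval_chebSep_other_8 (s3 s5 : k) :
    ∀ j : Fin 10, j ≠ 8 → eval (chebNodes s3 s5 j) (chebSep s3 s5 8) = 0 := by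
  intro j hij
  fin_cases j <;> first | exact absurd rfl hij | (simp [chebNodes, chebSep]; try ring)

/-- the `9`-th separator at the `9`-th node (a product of non-zero atoms). -/
theorem eval_chebSep_self_9 (s3 s5 : k) :
    eval (chebNodes s3 s5 9) (chebSep s3 s5 9) = (2 : k) ^ 6 * (s3 + 1) * (s3 - 1) * s5 := by
  simp [chebNodes, chebSep]
  ring

/-- the `9`-th separator vanishes at every other node. -/
theorem eval_chebSep_other_9 (s3 s5 : k) :
    ∀ j : Fin 10, j ≠ 9 → eval (chebNodes s3 s5 j) (chebSep s3 s5 9) = 0 := by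
  intro j hij
  fin_cases j <;> first | exact absurd rfl hij | (simp [chebNodes, chebSep]; try ring)

/-- **(CERT-EQ) FOR S_ν(6;10)^{Ch}**: for `char k ∉ {2, 3, 5}` the ten nodes of the Chebyshev sextic impose INDEPENDENT conditions on the ternary forms of degree
`6` — evaluation `k[x,y,z]₆ → k¹⁰` at `chebNodes s3 s5` is surjective (the `hcert` input of `Equinodal.exists_equinodal_lift`, the last conjunct of `EqCertAt₀`).
[OURS · specimen certificate · counted 0] -/
theorem certEq_chebyshev_surjective (s3 s5 : k) (h3 : s3 ^ 2 = 3) (h5 : s5 ^ 2 = 5)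
    (h2 : (2 : k) ≠ 0) (h3' : (3 : k) ≠ 0) (h5' : (5 : k) ≠ 0) :
    Function.Surjective (fun p : homogeneousSubmodule (Fin 3) k 6 => fun i => eval (chebNodes s3 s5 i) (p : MvPolynomial (Fin 3) k)) := by
  have hs3 : s3 ≠ 0 := fun h => h3' (by rw [← h3, h]; ring)
  have hs5 : s5 ≠ 0 := fun h => h5' (by rw [← h5, h]; ring)
  have hs3m : s3 - 1 ≠ 0 := fun h => h2 (by linear_combination (s3 + 1) * h - h3)
  have hs3p : s3 + 1 ≠ 0 := fun h => h2 (by linear_combination (s3 - 1) * h - h3)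
  refine surjective_eval_of_separators (chebNodes s3 s5) (chebSep s3 s5) (isHomogeneous_chebSep s3 s5) (fun i => ?_) (fun i => ?_)
  · fin_cases i
    · exact eval_chebSep_other_0 s3 s5
    · exact eval_chebSep_other_1 s3 s5
    · exact eval_chebSep_other_2 s3 s5
    · exact eval_chebSep_other_3 s3 s5
    · exact eval_chebSep_other_4 s3 s5
    · exact eval_chebSep_other_5 s3 s5
    · exact eval_chebSep_other_6 s3 s5
    · exact eval_chebSep_other_7 s3 s5
    · exact eval_chebSep_other_8 s3 s5
    · exact eval_chebSep_other_9 s3 s5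
  · fin_cases i
    · exact fun h => (mul_ne_zero (mul_ne_zero (mul_ne_zero (mul_ne_zero (pow_ne_zero 6 h2) hs3m) hs3p) (pow_ne_zero 2 hs3)) hs5) ((eval_chebSep_self_0 s3 s5).symm.trans h)
    · exact fun h => (neg_ne_zero.mpr (mul_ne_zero (mul_ne_zero (mul_ne_zero (mul_ne_zero (pow_ne_zero 6 h2) hs3m) hs3p) (pow_ne_zero 2 hs3)) hs5)) ((eval_chebSep_self_1 s3 s5).symm.trans h)
    · exact fun h => (mul_ne_zero (mul_ne_zero (pow_ne_zero 5 h2) (pow_ne_zero 2 hs3)) hs5) ((eval_chebSep_self_2 s3 s5).symm.trans h)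
    · exact fun h => (neg_ne_zero.mpr (mul_ne_zero (mul_ne_zero (pow_ne_zero 5 h2) (pow_ne_zero 2 hs3)) hs5)) ((eval_chebSep_self_3 s3 s5).symm.trans h)
    · exact fun h => (mul_ne_zero (mul_ne_zero (mul_ne_zero (mul_ne_zero (pow_ne_zero 6 h2) hs3p) hs3m) (pow_ne_zero 2 hs3)) hs5) ((eval_chebSep_self_4 s3 s5).symm.trans h)
    · exact fun h => (neg_ne_zero.mpr (mul_ne_zero (mul_ne_zero (mul_ne_zero (mul_ne_zero (pow_ne_zero 6 h2) hs3p) hs3m) (pow_ne_zero 2 hs3)) hs5)) ((eval_chebSep_self_5 s3 s5).symm.trans h)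
    · exact fun h => (neg_ne_zero.mpr (mul_ne_zero (mul_ne_zero (mul_ne_zero (pow_ne_zero 6 h2) hs3m) hs3p) hs5)) ((eval_chebSep_self_6 s3 s5).symm.trans h)
    · exact fun h => (mul_ne_zero (mul_ne_zero (mul_ne_zero (pow_ne_zero 6 h2) hs3m) hs3p) hs5) ((eval_chebSep_self_7 s3 s5).symm.trans h)
    · exact fun h => (neg_ne_zero.mpr (mul_ne_zero (mul_ne_zero (mul_ne_zero (pow_ne_zero 6 h2) hs3p) hs3m) hs5)) ((eval_chebSep_self_8 s3 s5).symm.trans h)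
    · exact fun h => (mul_ne_zero (mul_ne_zero (mul_ne_zero (pow_ne_zero 6 h2) hs3p) hs3m) hs5) ((eval_chebSep_self_9 s3 s5).symm.trans h)

/-- **`EqCertDet` shape for S_ν(6;10)^{Ch}**: ten degree-`6` monomials with invertible evaluation matrix at the nodes exist (pivot extraction from the surjectivity,
`Equinodal.exists_pivots_of_surjective` ✓ p670351). [OURS · specimen certificate · counted 0] -/
theorem eqCertDet_chebyshev (s3 s5 : k) (h3 : s3 ^ 2 = 3) (h5 : s5 ^ 2 = 5)
    (h2 : (2 : k) ≠ 0) (h3' : (3 : k) ≠ 0) (h5' : (5 : k) ≠ 0) :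
    ∃ m : Fin 10 → (Fin 3 →₀ ℕ), (∀ j, (m j).degree = 6) ∧
      (Matrix.of fun i j => eval (chebNodes s3 s5 i) (monomial (m j) (1 : k))).det ≠ 0 :=
  exists_pivots_of_surjective (chebNodes s3 s5) (certEq_chebyshev_surjective s3 s5 h3 h5 h2 h3' h5')

end Summit.ResolutionOfSingularities.ResolutionOfSingularities.Cruxes.EquisingularLiftNat.Sections.SNuSixTen

end
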